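import Summits.MatrixMultiplication.MatrixMultiplication.Theses.ThinBlockAlpha
import Literature.Computability.AlgebraicComplexity.MultinomialEntropy
import Literature.Computability.AlgebraicComplexity.LaserMethodTypes
import Mathlib.Analysis.SpecificLimits.Normed

/-!
# Candidate proof of STUB 3 `stub_classDesigns` of line `tame-charts` (refuter drefute seat; evidence for the lead)

Method of types: the full class `T(m·q)` of a tiling thin chart is an asymmetric thin design at every slack `η > 0`.
Definitions are VERBATIM copies of the skeleton's (`SymbolTPP`, `block`, `HasType`, `pieceSize`, `PiecesTile`, `ThinEnough`,
`AsymDesignAt`); the proof of `classDesigns_proof` transplants textually into `Lines/tame-charts.lean`.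
-/

set_option linter.dupNamespace false

namespace Summit.MatrixMultiplication.MatrixMultiplication.Cruxes.BoundedExponentThird.TameChartsStub3

open Finset Literature.Computability.AlgebraicComplexity

/-- verbatim copy of `TameCharts.SymbolTPP`. -/
def SymbolTPP {Z : Type} [AddCommGroup Z] (A B C : Finset Z) : Prop :=
  ∀ a ∈ A, ∀ a' ∈ A, ∀ b ∈ B, ∀ b' ∈ B, ∀ c ∈ C, ∀ c' ∈ C,
    (a' - a) + (b' - b) + (c' - c) = 0 → a = a' ∧ b = b' ∧ c = c'

/-- verbatim copy of `TameCharts.block`. -/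
def block {Z : Type} {k n : ℕ} (S : Fin k → Finset Z) (w : Fin n → Fin k) : Finset (Fin n → Z) :=
  Fintype.piFinset fun c => S (w c)

/-- verbatim copy of `TameCharts.HasType`. -/
def HasType {k n : ℕ} (w : Fin n → Fin k) (μ : Fin k → ℕ) : Prop :=
  ∀ x, (univ.filter fun c => w c = x).card = μ x

/-- verbatim copy of `TameCharts.pieceSize`. -/
def pieceSize {Z : Type} {k : ℕ} (SA SC : Fin k → Finset Z) (x : Fin k) : ℕ := (SA x).card * (SC x).card

/-- verbatim copy of `TameCharts.PiecesTile`. -/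
def PiecesTile {Z : Type} [AddCommGroup Z] {k : ℕ} (SA SC : Fin k → Finset Z) : Prop :=
  (∀ g : Z, ∃ x, ∃ a ∈ SA x, ∃ c ∈ SC x, c - a = g) ∧
  (∀ x y, ∀ a ∈ SA x, ∀ c ∈ SC x, ∀ a' ∈ SA y, ∀ c' ∈ SC y, c - a = c' - a' → x = y)

/-- verbatim copy of `TameCharts.ThinEnough`. -/
def ThinEnough {Z : Type} {k : ℕ} (SA SB SC : Fin k → Finset Z) : Prop :=
  ∏ x, pieceSize SA SC x ^ pieceSize SA SC x ≤ ∏ x, (SB x).card ^ (6 * pieceSize SA SC x)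

/-- verbatim copy of `TameCharts.AsymDesignAt`. -/
def AsymDesignAt (ℓ : ℕ) (η : ℝ) : Prop :=
  ∃ (H : Type) (_ : AddCommGroup H) (_ : Fintype H) (L N₁ M N₂ : ℕ) (A B C : Fin L → Finset H),
    AddMonoid.exponent H ≤ ℓ ∧ IsSTPP A B C ∧
    (∀ i, (A i).card = N₁ ∧ (B i).card = M ∧ (C i).card = N₂) ∧ 2 ≤ N₁ * N₂ ∧
    ((N₁ * N₂ : ℕ) : ℝ) ^ (1 / 3 : ℝ) ≤ (M : ℝ) ^ 2 ∧
    (Fintype.card H : ℝ) ≤ L * ((N₁ * N₂ : ℕ) : ℝ) ^ (1 + η)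

/-! ## Helpers -/

/-- Product of a symbol statistic over the coordinates of a word of type `μ`. -/
theorem prod_coord_eq_prod_type {k n : ℕ} {w : Fin n → Fin k} {μ : Fin k → ℕ} (hw : HasType w μ)
    (f : Fin k → ℕ) : ∏ c, f (w c) = ∏ x, f x ^ μ x := by
  rw [← Finset.prod_fiberwise (s := (univ : Finset (Fin n))) (g := w) (f := fun c => f (w c))]
  refine Finset.prod_congr rfl fun x _ => ?_
  have h1 : ∏ c ∈ univ.filter (fun c => w c = x), f (w c) = ∏ c ∈ univ.filter (fun c => w c = x), f x :=
    Finset.prod_congr rfl fun c hc => by rw [(Finset.mem_filter.mp hc).2]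
  rw [h1, Finset.prod_const, hw x]

/-- Cardinality of a product block of a word of type `μ`. -/
theorem card_block {Z : Type} {k n : ℕ} (S : Fin k → Finset Z) {w : Fin n → Fin k} {μ : Fin k → ℕ}
    (hw : HasType w μ) : (block S w).card = ∏ x, (S x).card ^ μ x := by
  unfold block
  rw [Fintype.card_piFinset]
  exact prod_coord_eq_prod_type hw fun x => (S x).card

/-- The pieces cover `Z`, so `|Z| ≤ Σ q_x`. -/
theorem card_le_sum_pieceSize {Z : Type} [AddCommGroup Z] [Fintype Z] {k : ℕ} (SA SC : Fin k → Finset Z)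
    (hcov : ∀ g : Z, ∃ x, ∃ a ∈ SA x, ∃ c ∈ SC x, c - a = g) :
    Fintype.card Z ≤ ∑ x, pieceSize SA SC x := by
  classical
  have hsub : (univ : Finset Z) ⊆ univ.biUnion fun x => ((SA x) ×ˢ (SC x)).image fun p => p.2 - p.1 := by
    intro g _
    obtain ⟨x, a, ha, c, hc, rfl⟩ := hcov g
    exact Finset.mem_biUnion.mpr ⟨x, mem_univ x, Finset.mem_image.mpr ⟨(a, c), Finset.mem_product.mpr ⟨ha, hc⟩, rfl⟩⟩
  calc Fintype.card Z = (univ : Finset Z).card := Finset.card_univ.symm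
    _ ≤ (univ.biUnion fun x => ((SA x) ×ˢ (SC x)).image fun p => p.2 - p.1).card := Finset.card_le_card hsub
    _ ≤ ∑ x, (((SA x) ×ˢ (SC x)).image fun p => p.2 - p.1).card := Finset.card_biUnion_le
    _ ≤ ∑ x, pieceSize SA SC x := Finset.sum_le_sum fun x _ =>
        (Finset.card_image_le).trans (by rw [Finset.card_product]; rfl)

/-- The real-analysis step: polynomial `(mQ+1)^k` is eventually below the exponential `P^{mη}` (`P > 1`, `η > 0`). -/
theorem exists_good_m {P : ℝ} (hP : 1 < P) {η : ℝ} (hη : 0 < η) (Q k : ℕ) :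
    ∃ m : ℕ, 1 ≤ m ∧ ((m * Q + 1 : ℕ) : ℝ) ^ k ≤ P ^ ((m : ℝ) * η) := by
  have hr : 1 < P ^ η := Real.one_lt_rpow hP hη
  have ht := tendsto_pow_const_div_const_pow_of_one_lt k hr
  have hC : (0 : ℝ) < 1 / ((Q : ℝ) + 1) ^ k := by positivity
  have hev := (ht.eventually (gt_mem_nhds hC)).and (Filter.eventually_ge_atTop 1)
  obtain ⟨m, hm⟩ := hev.exists
  obtain ⟨hlt, hm1⟩ := hm
  refine ⟨m, hm1, ?_⟩
  have hrpos : (0 : ℝ) < (P ^ η) ^ m := pow_pos (lt_trans zero_lt_one hr) m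
  -- from m^k / r^m < 1/(Q+1)^k get (Q+1)^k m^k < r^m
  rw [div_lt_div_iff₀ hrpos (by positivity), one_mul] at hlt
  have hmQ : ((m * Q + 1 : ℕ) : ℝ) ≤ (m : ℝ) * ((Q : ℝ) + 1) := by
    push_cast
    have : (1 : ℝ) ≤ m := by exact_mod_cast hm1
    nlinarith [(Nat.cast_nonneg Q : (0:ℝ) ≤ Q)]
  have hrw : P ^ ((m : ℝ) * η) = (P ^ η) ^ m := by
    rw [mul_comm, Real.rpow_mul (le_of_lt (lt_trans zero_lt_one hP)), Real.rpow_natCast]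
  rw [hrw]
  calc ((m * Q + 1 : ℕ) : ℝ) ^ k ≤ ((m : ℝ) * ((Q : ℝ) + 1)) ^ k :=
        pow_le_pow_left₀ (Nat.cast_nonneg _) hmQ k
    _ = (m : ℝ) ^ k * ((Q : ℝ) + 1) ^ k := mul_pow _ _ _
    _ ≤ (P ^ η) ^ m := le_of_lt hlt

/-- Exponent of the power group `Fin n → Z` is at most that of `Z`. -/
theorem exponent_pi_le {Z : Type} [AddCommGroup Z] [Fintype Z] (n : ℕ) :
    AddMonoid.exponent (Fin n → Z) ≤ AddMonoid.exponent Z := by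
  have hpos : 0 < AddMonoid.exponent Z := AddMonoid.ExponentExists.of_finite.exponent_pos
  refine Nat.le_of_dvd hpos (AddMonoid.exponent_dvd_of_forall_nsmul_eq_zero fun g => ?_)
  funext c
  simp [AddMonoid.exponent_nsmul_eq_zero]

/-! ## The stub -/

/-- **STUB 3** (`ClassDesigns` verbatim). -/
theorem classDesigns_proof :
    ∀ (ℓ : ℕ) (Z : Type) [AddCommGroup Z] [Fintype Z] (k : ℕ) (SA SB SC : Fin k → Finset Z),
      AddMonoid.exponent Z ≤ ℓ → (∀ x, SymbolTPP (SA x) (SB x) (SC x)) → PiecesTile SA SC →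
      (∃ x, 2 ≤ pieceSize SA SC x) → ThinEnough SA SB SC →
      (∀ (m n L : ℕ) (row : Fin L → Fin n → Fin k), Function.Injective row →
        (∀ i, HasType (row i) fun x => m * pieceSize SA SC x) →
        IsSTPP (fun i => block SA (row i)) (fun i => block SB (row i)) (fun i => block SC (row i))) →
      ∀ η : ℝ, 0 < η → AsymDesignAt ℓ η := by
  intro ℓ Z _ _ k SA SB SC hexp _hT hP hfat hthin hclass η hη
  classical
  -- notation
  set q : Fin k → ℕ := pieceSize SA SC with hq
  set Q : ℕ := ∑ x, q x with hQ
  set Pp : ℕ := ∏ x, q x ^ q x with hPp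
  set Bp : ℕ := ∏ x, (SB x).card ^ q x with hBp
  -- Pp ≥ 4 ≥ 2 (a non-point piece exists), Q ≥ 1
  obtain ⟨x₀, hx₀⟩ := hfat
  have hPp4 : 4 ≤ Pp := by
    have h1 : ∀ x ∈ (univ : Finset (Fin k)), 1 ≤ q x ^ q x := fun x _ => by
      rcases Nat.eq_zero_or_pos (q x) with h | h
      · rw [h, pow_zero]
      · exact Nat.one_le_pow _ _ h
    have h2 : q x₀ ^ q x₀ ≤ Pp := Finset.single_le_prod' h1 (mem_univ x₀)
    have h3 : 4 ≤ q x₀ ^ q x₀ := by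
      calc 4 = 2 ^ 2 := by norm_num
        _ ≤ q x₀ ^ 2 := Nat.pow_le_pow_left hx₀ 2
        _ ≤ q x₀ ^ q x₀ := Nat.pow_le_pow_right (by omega) hx₀
    omega
  have hQpos : 0 < Q := lt_of_lt_of_le (by omega : 0 < q x₀) (Finset.single_le_sum (fun x _ => Nat.zero_le (q x)) (mem_univ x₀))
  -- choose m
  have hPreal : (1 : ℝ) < (Pp : ℝ) := by exact_mod_cast (by omega : 1 < Pp)
  obtain ⟨m, hm1, hm⟩ := exists_good_m hPreal hη Q k
  -- the class
  set n : ℕ := m * Q with hn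
  set μ : Fin k → ℕ := fun x => m * q x with hμ
  have hμsum : ∑ x, μ x = n := by simp [hμ, hn, hQ, Finset.mul_sum]
  set T := typeClass n μ with hTdef
  set L := T.card with hL
  have hLmult : L = Nat.multinomial univ μ := card_typeClass_eq_multinomial n μ hμsum
  let e := T.equivFin
  let row : Fin L → Fin n → Fin k := fun i => (e.symm i).1
  have hrow_mem : ∀ i, row i ∈ T := fun i => (e.symm i).2
  have hinj : Function.Injective row := by
    intro i j hij
    have : e.symm i = e.symm j := Subtype.ext hij
    exact e.symm.injective this
  have htyp : ∀ i, HasType (row i) μ := by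
    intro i x
    have hmem := hrow_mem i
    rw [hTdef, mem_typeClass] at hmem
    have := congrFun hmem x
    rw [letterCount_apply] at this
    exact this
  have hS := hclass m n L row hinj htyp
  -- block cardinalities
  set N₁ : ℕ := ∏ x, (SA x).card ^ μ x with hN₁
  set M' : ℕ := ∏ x, (SB x).card ^ μ x with hM'
  set N₂ : ℕ := ∏ x, (SC x).card ^ μ x with hN₂
  have hcards : ∀ i, (block SA (row i)).card = N₁ ∧ (block SB (row i)).card = M' ∧ (block SC (row i)).card = N₂ :=
    fun i => ⟨card_block SA (htyp i), card_block SB (htyp i), card_block SC (htyp i)⟩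
  -- N₁ N₂ = Pp^m and M' = Bp^m
  have hN12 : N₁ * N₂ = Pp ^ m := by
    rw [hN₁, hN₂, ← Finset.prod_mul_distrib, hPp, ← Finset.prod_pow]
    refine Finset.prod_congr rfl fun x _ => ?_
    rw [← mul_pow, hμ]
    show ((SA x).card * (SC x).card) ^ (m * q x) = (q x ^ q x) ^ m
    rw [← pow_mul, mul_comm m]
    rfl
  have hM'eq : M' = Bp ^ m := by
    rw [hM', hBp, ← Finset.prod_pow]
    refine Finset.prod_congr rfl fun x _ => ?_
    show (SB x).card ^ (m * q x) = ((SB x).card ^ q x) ^ m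
    rw [← pow_mul, mul_comm m]
  -- thinness: Pp ≤ Bp^6
  have hthin' : Pp ≤ Bp ^ 6 := by
    have : ∏ x, (SB x).card ^ (6 * pieceSize SA SC x) = Bp ^ 6 := by
      rw [hBp, ← Finset.prod_pow]
      refine Finset.prod_congr rfl fun x _ => ?_
      rw [← pow_mul, mul_comm 6]
    rw [← this]; exact hthin
  refine ⟨Fin n → Z, inferInstance, inferInstance, L, N₁, M', N₂,
    fun i => block SA (row i), fun i => block SB (row i), fun i => block SC (row i),
    (exponent_pi_le n).trans hexp, hS, hcards, ?_, ?_, ?_⟩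
  · -- 2 ≤ N₁ N₂
    rw [hN12]
    calc 2 ≤ 4 := by norm_num
      _ ≤ Pp := hPp4
      _ ≤ Pp ^ m := Nat.le_self_pow (by omega) Pp
  · -- (N₁N₂)^{1/3} ≤ M'^2
    rw [hN12, hM'eq]
    have h6 : ((Pp ^ m : ℕ) : ℝ) ≤ ((Bp ^ m : ℕ) : ℝ) ^ (6 : ℕ) := by
      have : Pp ^ m ≤ (Bp ^ m) ^ 6 := by
        rw [← pow_mul, mul_comm m 6, pow_mul]; exact Nat.pow_le_pow_left hthin' m
      exact_mod_cast this
    have hB0 : (0 : ℝ) ≤ ((Bp ^ m : ℕ) : ℝ) := Nat.cast_nonneg _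
    calc ((Pp ^ m : ℕ) : ℝ) ^ (1 / 3 : ℝ) ≤ (((Bp ^ m : ℕ) : ℝ) ^ (6 : ℕ)) ^ (1 / 3 : ℝ) :=
          Real.rpow_le_rpow (Nat.cast_nonneg _) h6 (by norm_num)
      _ = ((Bp ^ m : ℕ) : ℝ) ^ 2 := by
          rw [← Real.rpow_natCast, ← Real.rpow_mul hB0]; norm_num
  · -- packing: |Z|^n ≤ L (Pp^m)^{1+η}
    have hZQ : Fintype.card Z ≤ Q := card_le_sum_pieceSize SA SC hP.1
    have hcardH : Fintype.card (Fin n → Z) = Fintype.card Z ^ n := by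
      rw [Fintype.card_fun, Fintype.card_fin]
    -- method of types
    have hmt := one_le_card_pow_mul_typeClassMass_self μ hμsum
    rw [Fintype.card_fin, ← hLmult] at hmt
    -- Q^n * ∏ (μ x / n)^(μ x) = Pp^m
    have hnpos : (0 : ℝ) < (n : ℝ) := by
      have : 0 < n := Nat.mul_pos (by omega) hQpos
      exact_mod_cast this
    have hkey : (Q : ℝ) ^ n * ∏ x, ((μ x : ℝ) / n) ^ μ x = ((Pp ^ m : ℕ) : ℝ) := by
      have hQn : (Q : ℝ) ^ n = ∏ x, (Q : ℝ) ^ μ x := by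
        rw [Finset.prod_pow_eq_pow_sum, hμsum]
      rw [hQn, ← Finset.prod_mul_distrib]
      push_cast
      rw [hPp]
      push_cast
      rw [← Finset.prod_pow]
      refine Finset.prod_congr rfl fun x _ => ?_
      rw [← mul_pow, hμ]
      have hmq : (Q : ℝ) * (((m * q x : ℕ) : ℝ) / (n : ℝ)) = (q x : ℝ) := by
        rw [hn]; push_cast
        have hm0 : (m : ℝ) ≠ 0 := by exact_mod_cast (by omega : m ≠ 0)
        have hQ0 : (Q : ℝ) ≠ 0 := by exact_mod_cast (by omega : Q ≠ 0)
        field_simp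
      rw [hmq]
      show (q x : ℝ) ^ (m * q x) = ((q x : ℝ) ^ q x) ^ m
      rw [← pow_mul, mul_comm]
    -- assemble: (card Z)^n ≤ Q^n ≤ (n+1)^k * L * Pp^m ≤ Pp^{mη} * L * Pp^m = L * (Pp^m)^(1+η)
    have hstep1 : ((Fintype.card Z : ℝ)) ^ n ≤ (Q : ℝ) ^ n :=
      pow_le_pow_left₀ (Nat.cast_nonneg _) (by exact_mod_cast hZQ) n
    have hstep2 : (Q : ℝ) ^ n ≤ ((n : ℝ) + 1) ^ k * (L : ℝ) * ((Pp ^ m : ℕ) : ℝ) := by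
      have hQn0 : (0 : ℝ) ≤ (Q : ℝ) ^ n := by positivity
      have := mul_le_mul_of_nonneg_left hmt hQn0
      rw [mul_one] at this
      calc (Q : ℝ) ^ n ≤ (Q : ℝ) ^ n * (((n : ℝ) + 1) ^ k * ((L : ℝ) * ∏ x, ((μ x : ℝ) / n) ^ μ x)) := this
        _ = ((n : ℝ) + 1) ^ k * (L : ℝ) * ((Q : ℝ) ^ n * ∏ x, ((μ x : ℝ) / n) ^ μ x) := by ring
        _ = ((n : ℝ) + 1) ^ k * (L : ℝ) * ((Pp ^ m : ℕ) : ℝ) := by rw [hkey]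
    have hstep3 : ((n : ℝ) + 1) ^ k ≤ (Pp : ℝ) ^ ((m : ℝ) * η) := by
      have : ((n : ℝ) + 1) = ((m * Q + 1 : ℕ) : ℝ) := by rw [hn]; push_cast; ring
      rw [this]; exact hm
    have hPpos : (0 : ℝ) < (Pp : ℝ) := lt_trans zero_lt_one hPreal
    have hfinal : ((Pp : ℝ) ^ ((m : ℝ) * η)) * (L : ℝ) * ((Pp ^ m : ℕ) : ℝ) =
        (L : ℝ) * (((Pp ^ m : ℕ) : ℝ)) ^ (1 + η) := by
      rw [Real.rpow_add (by positivity) 1 η, Real.rpow_one]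
      push_cast
      rw [← Real.rpow_natCast (Pp : ℝ) m, ← Real.rpow_mul (le_of_lt hPpos)]
      ring
    rw [hcardH, hN12]
    push_cast
    calc ((Fintype.card Z : ℝ)) ^ n ≤ (Q : ℝ) ^ n := hstep1
      _ ≤ ((n : ℝ) + 1) ^ k * (L : ℝ) * ((Pp ^ m : ℕ) : ℝ) := hstep2
      _ ≤ (Pp : ℝ) ^ ((m : ℝ) * η) * (L : ℝ) * ((Pp ^ m : ℕ) : ℝ) := by
          gcongr
      _ = (L : ℝ) * (((Pp ^ m : ℕ) : ℝ)) ^ (1 + η) := hfinal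
      _ = (L : ℝ) * ((Pp : ℝ) ^ m) ^ (1 + η) := by push_cast; ring

end Summit.MatrixMultiplication.MatrixMultiplication.Cruxes.BoundedExponentThird.TameChartsStub3
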